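import Summits.QuantumFields.YangMills.Theorems.UnitScaleTiltProp7PinnedHarmonicMass
import Summits.QuantumFields.YangMills.Theorems.UnitScaleTiltProp7CovariantWeitzenbock
import HarnessLib

/-!
# Route `UnitScaleTilt`, crux K1 «MinimiserStabilityRegPr» (stmt-QuantumFields-19200), route-R E′ path (α′), scheme (E1) at the CURVED background — (E1-a-cov):
# UNIQUENESS OF THE PINNED `Δ_U`-BIHARMONIC INTERPOLANT, EXACTLY (no frames, no `O(e)`, any unitary background, any dimension):
# `χ|_C = 0 ∧ Δ_U(Δ_Uχ) = 0 off C ⇒ χ = 0`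

Cell `ym3-torus`, extra width seat `ym-routeR-w6` (gen 6).  THEOREMS ONLY (0 `def`, 0 `sorry`); `--supports stmt-QuantumFields-19200`, count-neutral.  YM₃ on T³ is a ladder rung (R3),
not the Clay problem; nothing here claims a stub, the crux, d = 4 or the mass gap.

WHY.  ★routeR-w3 g5's (E1) scheme (LOCATE `ym-routeR-w3/LOCATE-E1-CONTRACTION-routeRw3g5.md`, ★p1 g15 20:45:05Z «scheme of record») rewrites the exact slice equation as the fixed
point `ψ = LinCorr(D‴) + LinCorr(N(ψ))`; the equivalence `R(ψ) = 0 ⟺ ψ = Φ(ψ)` rests on ONE fact — the kernel of `P_off Δ_W²` on pinned gauge functions is `{0}` — landed FLAT as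
✓ `Prop7PinnedBiharmonicUniqueness.eq_zero_of_vanish_centres_of_bilaplace_off` (via (D1-glob)).  At the curved background `W` the same fact holds EXACTLY and more cheaply:
`Σ_x hs(Δ_Uχ) = Σ_x Re Tr(χ^* Δ_U²χ)` (self-adjointness of `Δ_U`, [B9] (3.8)) vanishes because `χ` kills the centres and `Δ_U²χ` kills the rest; so `Δ_Uχ ≡ 0`, and a covariantly
harmonic field vanishing on the (homogeneous, nonempty) centre set vanishes identically by the tree's Kato∕sub-mean letter ✓ `Prop7PinnedHarmonicMass.card_mul_sum_norm_sq_le_of_covHarmonic_off`.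
No perturbation in `e`, no (D1-cov), no dimension.

WHAT IS PROVED (ns `…Theorems.Prop7PinnedCovBiharmonicUniqueness`; torus `Site P j`, `T = torusT P j`, unitary `U : Fin P.d → Site P j → (M_N ℂ)ˣ`, `Δ_Uχ = divB T U (fun μ => covD T U μ χ)`).
* §1 ★ `sum_hs_covLaplace_eq_re_trace` — `Σ_x Σ_{jk}‖(Δ_Uχ)(x)_{jk}‖² = Σ_x Re Tr(χ(x)^*·(Δ_U(Δ_Uχ))(x))` (✓ `sum_sum_covD_mul` twice + ✓ `conjTranspose_covD`).
* §2 ★★ `covLaplace_eq_zero_of_pinned_bilaplace_off` — `χ|_C = 0`, `Δ_U²χ = 0` off `C` ⇒ `Δ_Uχ ≡ 0`.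
* §3 ★★★ `eq_zero_of_pinned_covBilaplace_off` (nonempty homogeneous finset `C`) and the T³ reading ★★★ `eq_zero_of_vanish_centres_of_covBilaplace_off_T3` (`C = ι_k(T^{(k)})`, `SU(2)`
  background in p483802's letters), with the corollary ★★ `covInterpolant_unique_T3`: two pinned `Δ_W`-biharmonic interpolants of the same centre data coincide.
HONEST SCOPE.  Exact linear algebra; the EXISTENCE of the interpolant ∕ of `LinCorr` and every size row ((hK₀)(hK)(hK₂), P-cov2) are elsewhere.

References: T. Bałaban, CMP 99 (1985) 389–434 [Balaban1985BackgroundPropagators] ((3.8) p.392); CMP 99 (1985) 75–102 [Balaban1985RegularSpaces] ((1.14) p.78);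
CMP 102 (1985) 277–309 [Balaban1985Variational] (Prop. 7 p.299).
-/

set_option autoImplicit false

noncomputable section

open scoped BigOperators Matrix.Norms.L2Operator Matrix

namespace Summit.QuantumFields.YangMills.Theorems.Prop7PinnedCovBiharmonicUniqueness

open Literature.MathematicalPhysics.QuantumFieldTheory.Balaban1983to89
open B9Eq39Adjoint (R covD divB sum_sum_covD_mul)
open B9TorusCalculus (torusT)
open Summit.QuantumFields.YangMills.Theorems.Prop7CovariantCoercivity (mem_U1_of_unitary conjTranspose_covD re_trace_conjTranspose_mul_self
  re_trace_conjTranspose_mul_comm re_trace_mul_comm)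
open Summit.QuantumFields.YangMills.Theorems.Prop7PinnedHarmonicMass (card_mul_sum_norm_sq_le_of_covHarmonic_off)

variable {P : Params} {j : ℕ} {N : ℕ} [NeZero N]

/-! ## §1 Self-adjointness: the HS mass of `Δ_Uχ` is the pairing of `χ` with `Δ_U²χ` -/

omit [NeZero N] in
/-- ★ **`Σ_x hs(Δ_Uχ(x)) = Σ_x Re Tr(χ(x)^*·Δ_U(Δ_Uχ)(x))`** at a unitary background ([B9] (3.8) adjointness, used twice). [cite: Balaban1985BackgroundPropagators, (3.8) p.392] -/
theorem sum_hs_covLaplace_eq_re_trace {U : Fin P.d → Site P j → (Matrix (Fin N) (Fin N) ℂ)ˣ}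
    (hU : ∀ ν x, (U ν x : Matrix (Fin N) (Fin N) ℂ) ∈ unitary (Matrix (Fin N) (Fin N) ℂ)) (χ : Site P j → Matrix (Fin N) (Fin N) ℂ) :
    ∑ x : Site P j, ∑ a : Fin N, ∑ b : Fin N, ‖(divB (torusT P j) U (fun μ => covD (torusT P j) U μ χ) x) a b‖ ^ 2
      = ∑ x : Site P j, (((χ x)ᴴ * divB (torusT P j) U (fun μ => covD (torusT P j) U μ
          (fun y => divB (torusT P j) U (fun ν => covD (torusT P j) U ν χ) y)) x).trace).re := by
  set τ := Complex.reAddGroupHom.comp (Matrix.traceAddMonoidHom (Fin N) ℂ) with hτ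
  have hτa : ∀ A : Matrix (Fin N) (Fin N) ℂ, τ A = (A.trace).re := fun A => by simp [hτ]
  set ρ : Site P j → Matrix (Fin N) (Fin N) ℂ := fun y => divB (torusT P j) U (fun ν => covD (torusT P j) U ν χ) y with hρ
  -- `⟨χ, D*D ρ⟩ = ⟨Dχ, Dρ⟩`
  have h1 := sum_sum_covD_mul (torusT P j) U τ re_trace_mul_comm (fun z => (χ z)ᴴ) (fun μ => covD (torusT P j) U μ ρ)
  -- `⟨ρ, D*D χ⟩ = ⟨Dρ, Dχ⟩`, and `D*Dχ = ρ`
  have h2 := sum_sum_covD_mul (torusT P j) U τ re_trace_mul_comm (fun z => (ρ z)ᴴ) (fun μ => covD (torusT P j) U μ χ)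
  have hl : ∀ x μ, τ (covD (torusT P j) U μ (fun z => (χ z)ᴴ) x * covD (torusT P j) U μ ρ x)
      = τ (covD (torusT P j) U μ (fun z => (ρ z)ᴴ) x * covD (torusT P j) U μ χ x) := by
    intro x μ
    rw [← conjTranspose_covD hU, ← conjTranspose_covD hU, hτa, hτa, re_trace_conjTranspose_mul_comm]
  have h12 : ∑ x : Site P j, τ ((χ x)ᴴ * divB (torusT P j) U (fun μ => covD (torusT P j) U μ ρ) x)
      = ∑ x : Site P j, τ ((ρ x)ᴴ * divB (torusT P j) U (fun μ => covD (torusT P j) U μ χ) x) := by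
    rw [← h1, ← h2]
    exact Finset.sum_congr rfl fun x _ => Finset.sum_congr rfl fun μ _ => hl x μ
  have hr : ∀ x, τ ((ρ x)ᴴ * divB (torusT P j) U (fun μ => covD (torusT P j) U μ χ) x) = ∑ a : Fin N, ∑ b : Fin N, ‖(ρ x) a b‖ ^ 2 := by
    intro x
    rw [hτa]
    exact re_trace_conjTranspose_mul_self (ρ x)
  simp only [hr] at h12
  rw [← h12]
  exact Finset.sum_congr rfl fun x _ => hτa _

/-! ## §2 Pinned + biharmonic off the pins ⇒ covariantly harmonic everywhere -/

omit [NeZero N] in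
/-- ★★ **`χ|_C = 0` and `Δ_U(Δ_Uχ) = 0` off `C` imply `Δ_Uχ ≡ 0`** (the pairing of §1 vanishes term by term). [cite: Balaban1985RegularSpaces, (1.14) p.78] -/
theorem covLaplace_eq_zero_of_pinned_bilaplace_off {U : Fin P.d → Site P j → (Matrix (Fin N) (Fin N) ℂ)ˣ}
    (hU : ∀ ν x, (U ν x : Matrix (Fin N) (Fin N) ℂ) ∈ unitary (Matrix (Fin N) (Fin N) ℂ)) (C : Set (Site P j))
    (χ : Site P j → Matrix (Fin N) (Fin N) ℂ) (h0 : ∀ y ∈ C, χ y = 0)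
    (hbi : ∀ x ∉ C, divB (torusT P j) U (fun μ => covD (torusT P j) U μ
          (fun y => divB (torusT P j) U (fun ν => covD (torusT P j) U ν χ) y)) x = 0) (x : Site P j) :
    divB (torusT P j) U (fun μ => covD (torusT P j) U μ χ) x = 0 := by
  classical
  have hsum := sum_hs_covLaplace_eq_re_trace hU χ
  have hzero : ∑ x : Site P j, (((χ x)ᴴ * divB (torusT P j) U (fun μ => covD (torusT P j) U μ
          (fun y => divB (torusT P j) U (fun ν => covD (torusT P j) U ν χ) y)) x).trace).re = 0 := by
    refine Finset.sum_eq_zero fun y _ => ?_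
    by_cases hy : y ∈ C
    · rw [h0 y hy, Matrix.conjTranspose_zero, zero_mul, Matrix.trace_zero, Complex.zero_re]
    · rw [hbi y hy, mul_zero, Matrix.trace_zero, Complex.zero_re]
  rw [hzero] at hsum
  -- a sum of nonnegative terms vanishing: every term vanishes
  have hterm : ∀ y : Site P j, ∑ a : Fin N, ∑ b : Fin N, ‖(divB (torusT P j) U (fun μ => covD (torusT P j) U μ χ) y) a b‖ ^ 2 = 0 := by
    intro y
    have h := (Finset.sum_eq_zero_iff_of_nonneg fun z _ => Finset.sum_nonneg fun a _ => Finset.sum_nonneg fun b _ => sq_nonneg _).1 hsum y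
      (Finset.mem_univ _)
    exact h
  ext a b
  have h := hterm x
  have hab : ‖(divB (torusT P j) U (fun μ => covD (torusT P j) U μ χ) x) a b‖ ^ 2 = 0 := by
    have hnn : ∀ a' b', 0 ≤ ‖(divB (torusT P j) U (fun μ => covD (torusT P j) U μ χ) x) a' b'‖ ^ 2 := fun _ _ => sq_nonneg _
    have ha := (Finset.sum_eq_zero_iff_of_nonneg fun a' _ => Finset.sum_nonneg fun b' _ => hnn a' b').1 h a (Finset.mem_univ _)
    exact (Finset.sum_eq_zero_iff_of_nonneg fun b' _ => hnn a b').1 ha b (Finset.mem_univ _)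
  rw [Matrix.zero_apply]
  exact norm_eq_zero.1 (pow_eq_zero_iff two_ne_zero |>.1 hab)

/-! ## §3 ★★★ Uniqueness of the pinned `Δ_U`-biharmonic interpolant -/

/-- ★★★ **`χ|_C = 0 ∧ Δ_U²χ = 0` off `C` ⇒ `χ = 0`** for a nonempty homogeneous finset of pins `C` on the torus and any unitary background (§2 + the tree's covariant
sub-mean letter). [cite: Balaban1985RegularSpaces, (1.14) p.78; Balaban1985BackgroundPropagators, (3.8) p.392] -/
theorem eq_zero_of_pinned_covBilaplace_off {U : Fin P.d → Site P j → (Matrix (Fin N) (Fin N) ℂ)ˣ}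
    (hU : ∀ ν x, (U ν x : Matrix (Fin N) (Fin N) ℂ) ∈ unitary (Matrix (Fin N) (Fin N) ℂ))
    (C : Finset (Site P j)) (hC : C.Nonempty)
    (htrans : ∀ c ∈ C, ∀ c' ∈ C, ∃ a : Site P j, (∀ x : Site P j, x ∈ C ↔ x + a ∈ C) ∧ c + a = c')
    (χ : Site P j → Matrix (Fin N) (Fin N) ℂ) (h0 : ∀ y ∈ C, χ y = 0)
    (hbi : ∀ x ∉ C, divB (torusT P j) U (fun μ => covD (torusT P j) U μ
          (fun y => divB (torusT P j) U (fun ν => covD (torusT P j) U ν χ) y)) x = 0) :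
    χ = 0 := by
  classical
  have hU1 : ∀ κ y, ‖(U κ y : Matrix (Fin N) (Fin N) ℂ)‖ ≤ 1 ∧ ‖(((U κ y)⁻¹ : (Matrix (Fin N) (Fin N) ℂ)ˣ) : Matrix (Fin N) (Fin N) ℂ)‖ ≤ 1 :=
    fun κ y => mem_U1_of_unitary (hU κ y)
  have hharm : ∀ x : Site P j, x ∉ (C : Set (Site P j)) → divB (torusT P j) U (fun μ => covD (torusT P j) U μ χ) x = 0 :=
    fun x _ => covLaplace_eq_zero_of_pinned_bilaplace_off hU (C : Set (Site P j)) χ (fun y hy => h0 y hy) (fun y hy => hbi y hy) x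
  have hmass := card_mul_sum_norm_sq_le_of_covHarmonic_off U hU1 C hC htrans χ (fun x hx => hharm x hx)
  have hCsum : ∑ c ∈ C, ‖χ c‖ ^ 2 = 0 := Finset.sum_eq_zero fun c hc => by rw [h0 c hc, norm_zero]; ring
  rw [hCsum, mul_zero] at hmass
  have hpos : (0 : ℝ) < C.card := by exact_mod_cast hC.card_pos
  have hsum0 : ∑ x : Site P j, ‖χ x‖ ^ 2 = 0 :=
    le_antisymm (by nlinarith [hmass, Finset.sum_nonneg fun x (_ : x ∈ Finset.univ) => sq_nonneg ‖χ x‖]) (Finset.sum_nonneg fun _ _ => sq_nonneg _)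
  funext x
  have hx := (Finset.sum_eq_zero_iff_of_nonneg fun y _ => sq_nonneg ‖χ y‖).1 hsum0 x (Finset.mem_univ _)
  exact norm_eq_zero.1 (pow_eq_zero_iff two_ne_zero |>.1 hx)

/-! ## §4 The T³ reading: `C = ι_k(T^{(k)})`, `SU(2)` background -/

section T3

open Literature.MathematicalPhysics.QuantumFieldTheory.Balaban1983to89.T3ContinuumYM3Torus
open B10Eq27TorusAxialLog (unitsField toUField)
open B15DeterminingSets (embIter)
open Summit.QuantumFields.YangMills.Theorems.Prop7CovHodgeSplit (unitsField_toUField_mem_unitary)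
open Summit.QuantumFields.YangMills.Theorems.Prop7PinnedHarmonicMass (centres_homogeneous)

/-- ★★★ **UNIQUENESS OF THE PINNED `Δ_W`-BIHARMONIC GAUGE FUNCTION ON THE T³ CARRIER** (run `K` of a T³ family, ANY `SU(2)` background `W` in p483802's letters, any `k`): a matrix
site field vanishing on the `k`-centres whose covariant bi-Laplacian vanishes off them is zero. [cite: Balaban1985RegularSpaces, (1.14) p.78; Balaban1985Variational, Prop. 7 p.299] -/
theorem eq_zero_of_vanish_centres_of_covBilaplace_off_T3 (F : T3Family) (K k : ℕ)
    (W : GaugeField (F.P K) 0 (Matrix.specialUnitaryGroup (Fin 2) ℂ)) (χ : Site (F.P K) 0 → Matrix (Fin 2) (Fin 2) ℂ)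
    (h0 : ∀ y : Site (F.P K) k, χ (embIter k y) = 0)
    (hbi : ∀ x : Site (F.P K) 0, x ∉ Set.range (embIter k) →
      divB (torusT (F.P K) 0) (fun κ z => unitsField (toUField W) ⟨z, κ⟩)
        (fun μ => covD (torusT (F.P K) 0) (fun κ z => unitsField (toUField W) ⟨z, κ⟩) μ
          (fun y => divB (torusT (F.P K) 0) (fun κ z => unitsField (toUField W) ⟨z, κ⟩)
            (fun ν => covD (torusT (F.P K) 0) (fun κ z => unitsField (toUField W) ⟨z, κ⟩) ν χ) y)) x = 0) :
    χ = 0 := by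
  classical
  set C : Finset (Site (F.P K) 0) := (Finset.univ : Finset (Site (F.P K) k)).image (embIter k) with hCdef
  have hCne : C.Nonempty := ⟨embIter k default, Finset.mem_image_of_mem _ (Finset.mem_univ _)⟩
  have hU := fun κ (z : Site (F.P K) 0) => unitsField_toUField_mem_unitary W κ z
  refine eq_zero_of_pinned_covBilaplace_off (U := fun κ z => unitsField (toUField W) ⟨z, κ⟩) hU C hCne (centres_homogeneous k) χ ?_ ?_
  · intro y hy
    rw [hCdef, Finset.mem_image] at hy
    obtain ⟨y', _, rfl⟩ := hy
    exact h0 y'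
  · intro x hx
    refine hbi x fun ⟨y, hy⟩ => hx ?_
    rw [hCdef, Finset.mem_image]
    exact ⟨y, Finset.mem_univ _, hy⟩

/-- ★★ **TWO PINNED `Δ_W`-BIHARMONIC INTERPOLANTS OF THE SAME CENTRE DATA COINCIDE** (T³ carrier, any `SU(2)` background): if `φ₁, φ₂` agree with `φ` on the `k`-centres and
`Δ_W²φ₁ = Δ_W²φ₂ = 0` off them, then `φ₁ = φ₂` — so P-cov1's `φ_H` and (E1)'s `LinCorr` are well defined at the curved background. [cite: Balaban1985RegularSpaces, (1.14) p.78] -/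
theorem covInterpolant_unique_T3 (F : T3Family) (K k : ℕ)
    (W : GaugeField (F.P K) 0 (Matrix.specialUnitaryGroup (Fin 2) ℂ)) (φ φ₁ φ₂ : Site (F.P K) 0 → Matrix (Fin 2) (Fin 2) ℂ)
    (h₁ : ∀ y : Site (F.P K) k, φ₁ (embIter k y) = φ (embIter k y)) (h₂ : ∀ y : Site (F.P K) k, φ₂ (embIter k y) = φ (embIter k y))
    (hbi₁ : ∀ x : Site (F.P K) 0, x ∉ Set.range (embIter k) →
      divB (torusT (F.P K) 0) (fun κ z => unitsField (toUField W) ⟨z, κ⟩)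
        (fun μ => covD (torusT (F.P K) 0) (fun κ z => unitsField (toUField W) ⟨z, κ⟩) μ
          (fun y => divB (torusT (F.P K) 0) (fun κ z => unitsField (toUField W) ⟨z, κ⟩)
            (fun ν => covD (torusT (F.P K) 0) (fun κ z => unitsField (toUField W) ⟨z, κ⟩) ν φ₁) y)) x = 0)
    (hbi₂ : ∀ x : Site (F.P K) 0, x ∉ Set.range (embIter k) →
      divB (torusT (F.P K) 0) (fun κ z => unitsField (toUField W) ⟨z, κ⟩)
        (fun μ => covD (torusT (F.P K) 0) (fun κ z => unitsField (toUField W) ⟨z, κ⟩) μ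
          (fun y => divB (torusT (F.P K) 0) (fun κ z => unitsField (toUField W) ⟨z, κ⟩)
            (fun ν => covD (torusT (F.P K) 0) (fun κ z => unitsField (toUField W) ⟨z, κ⟩) ν φ₂) y)) x = 0) :
    φ₁ = φ₂ := by
  -- the difference is pinned and biharmonic off the centres (linearity of `covD`, `divB`)
  set U : Fin (F.P K).d → Site (F.P K) 0 → (Matrix (Fin 2) (Fin 2) ℂ)ˣ := fun κ z => unitsField (toUField W) ⟨z, κ⟩ with hUdef
  have hlinD : ∀ (f g : Site (F.P K) 0 → Matrix (Fin 2) (Fin 2) ℂ) (μ : Fin (F.P K).d) (x : Site (F.P K) 0),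
      covD (torusT (F.P K) 0) U μ (fun z => f z - g z) x = covD (torusT (F.P K) 0) U μ f x - covD (torusT (F.P K) 0) U μ g x := by
    intro f g μ x
    simp only [covD, B9Eq39Adjoint.R_sub]
    abel
  have hlinL : ∀ (f g : Site (F.P K) 0 → Matrix (Fin 2) (Fin 2) ℂ) (x : Site (F.P K) 0),
      divB (torusT (F.P K) 0) U (fun μ => covD (torusT (F.P K) 0) U μ (fun z => f z - g z)) x
        = divB (torusT (F.P K) 0) U (fun μ => covD (torusT (F.P K) 0) U μ f) x - divB (torusT (F.P K) 0) U (fun μ => covD (torusT (F.P K) 0) U μ g) x := by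
    intro f g x
    simp only [divB, B9Eq39Adjoint.covDstar, hlinD, B9Eq39Adjoint.R_sub, ← Finset.sum_sub_distrib]
    refine Finset.sum_congr rfl fun μ _ => ?_
    abel
  have h := eq_zero_of_vanish_centres_of_covBilaplace_off_T3 F K k W (fun z => φ₁ z - φ₂ z) (fun y => by simp [h₁ y, h₂ y]) ?_
  · funext x; exact sub_eq_zero.1 (congrFun h x)
  · intro x hx
    have e1 : (fun y => divB (torusT (F.P K) 0) U (fun ν => covD (torusT (F.P K) 0) U ν (fun z => φ₁ z - φ₂ z)) y)
        = fun y => divB (torusT (F.P K) 0) U (fun ν => covD (torusT (F.P K) 0) U ν φ₁) y - divB (torusT (F.P K) 0) U (fun ν => covD (torusT (F.P K) 0) U ν φ₂) y := by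
      funext y; exact hlinL φ₁ φ₂ y
    show divB (torusT (F.P K) 0) U (fun μ => covD (torusT (F.P K) 0) U μ
      (fun y => divB (torusT (F.P K) 0) U (fun ν => covD (torusT (F.P K) 0) U ν (fun z => φ₁ z - φ₂ z)) y)) x = 0
    rw [e1, hlinL, hbi₁ x hx, hbi₂ x hx, sub_zero]

end T3

end Summit.QuantumFields.YangMills.Theorems.Prop7PinnedCovBiharmonicUniqueness

end
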